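import Summits.QuantumFields.BalabanUV.T4Continuum.Support.NE7BoxReflectionCurlDiv
import Summits.QuantumFields.BalabanUV.T4Continuum.Support.NE7TorusSupFromCurlDiv
import Summits.QuantumFields.BalabanUV.T4Continuum.Support.NE7GradientCurrencyLandauEL
import HarnessLib

/-!
# NE7 — THE A PRIORI SUP LETTER OF A FREE-BOUNDARY LATTICE LANDAU GAUGE ON A BOX, NO LOGARITHM: (i) linear — a bond field on the box
# `lo + [0,M)ᵈ` with box curls `≤ C_c` and FREE-BOUNDARY divergence `≤ C_d` has `‖A‖ ≤ 64d²M·(d·C_c + C_d)` on every box bond; (ii) Landau —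
# if `W = e^{A}` (‖A‖ ≤ ρ) has plaquettes `‖W(∂p) − 1‖ ≤ ε` on the box and satisfies the free-boundary Euler–Lagrange (Neumann lattice Landau)
# condition `div_free (e^{A} − e^{−A}) = 0`, then `‖A‖ ≤ 64d³M·(ε + 4ρ(e^{4ρ} − 1) + 2ρ(e^{ρ} − 1))` (F309b)

Cell `pub-balaban`, rung (B)+1 sub-cell t4, lineage `b2b-balaban-t4-ne7-p1` (CRUX PROVER NE7 #1 = OWNER of row NE7), generation 93; memo
`t4/b2b-balaban-t4-ne7-p1-g93/UHLENBECK-ROAD.md` §2.  Over F308b `NE7BoxReflection.exists_box_reflection` (the cell-centred doubling), F309a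
`NE7TorusSupFromCurlDiv.osc_le_of_curl_div` (torus oscillation letter from curl + divergence), (157) `NE7GradientCurrency.norm_plaqRem_sub_plaqRem_le`
(plaquette remainder) and (158b) `NE7GradientCurrencyLandauEL.norm_sinhRem_sub_sinhRem_le` (`sinh − id`).

THE ESTIMATE (ii) IS THE BOOTSTRAP HALF OF THE ONE-SCALE LATTICE UHLENBECK LEMMA (road (U-CM)): with `K = 64d³M`, a Landau gauge on the box with
`sup‖A‖ ≤ ρ⋆ := 4Kε` improves to `sup‖A‖ ≤ ρ⋆∕2` as soon as `K·ρ⋆ ≲ 1`, i.e. `M²ε ≲ 1` — the small-curvature regime of the cube in the NE7 chart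
(`(ℓM)²·r∕M² = ℓ²r ≪ 1`).  The existence half (continuity method) is the successor files F310–F313.

WHAT ([folklore]; 0 def, 0 sorry):
* §1 **`box_sup_le_of_curl_freeDiv`** — the linear letter (i): double the box (F308b), read the oscillation letter on the torus of period `2M` (F309a),
  anchor at a straddling bond where the doubled field vanishes.
* §2 `norm_plaq_linear_le` (the linear curl of `A` from the plaquette of `e^{A}`: `≤ ε + 4ρ(e^{4ρ}−1)`), `norm_freeDiv_le_of_EL` (the free divergence of
  `A` from the Euler–Lagrange condition: `≤ 2d·ρ(e^ρ − 1)`), and **`landau_box_sup_le`** — the Landau letter (ii).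
HONEST FRAMING (page 1): lattice analysis on `ℤᵈ` for ARBITRARY box bond fields; nothing of Bałaban's asserted; the existence of a small Landau gauge
(the other half of (LSUP-EL)) is NOT proved here; NE7 NOT PROVED; spine 0∕9; finite T⁴ rung (B)+1 — NOT infinite volume, NOT mass gap, NOT
`BetaPertH`, NOT Clay.  No `sorry`; axioms ⊆ {propext, Classical.choice, Quot.sound}.
-/

set_option autoImplicit false

open scoped BigOperators Matrix.Norms.L2Operator Classical
open Finset NormedSpace

namespace Summit.QuantumFields.BalabanUV.T4Continuum.NE7BoxLandauSupAPriori

open Literature.MathematicalPhysics.QuantumFieldTheory.Balaban1983to89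
open B7Prop1Explicit
open NE7BoxReflection (exists_box_reflection add_zsmul_e_apply_self add_e_apply_ne)
open NE7TorusSupFromCurlDiv (osc_le_of_curl_div)
open NE7GradientCurrency (norm_plaqRem_sub_plaqRem_le)
open NE7GradientCurrencyLandauEL (norm_sinhRem_sub_sinhRem_le)

noncomputable section

variable {d : ℕ} {n : Type*} [Fintype n] [DecidableEq n]

/-! ## §1 The linear letter on the box -/

set_option maxHeartbeats 800000 in
/-- **THE SUP LETTER OF A BOX BOND FIELD FROM ITS BOX CURLS AND ITS FREE-BOUNDARY DIVERGENCE** (`d ≥ 1`, `M ≥ 2`): if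
`‖A(q)_μ + A(q+e_μ)_ν − A(q+e_ν)_μ − A(q)_ν‖ ≤ C_c` for every plaquette with its four corners in the box `lo + [0,M)ᵈ` (`C_c ≥ 0`) and the
free-boundary divergence `‖Σ_κ [𝟙(y+e_κ ∈ box) A(y)_κ − 𝟙(y−e_κ ∈ box) A(y−e_κ)_κ]‖ ≤ C_d` at every box site `y`, then
`‖A(x)_μ‖ ≤ 64d²M·(d·C_c + C_d)` on every bond `(x, x+e_μ)` of the box. [folklore] -/
theorem box_sup_le_of_curl_freeDiv (hd : 1 ≤ d) {M : ℕ} (hM : 2 ≤ M) (lo : Site d) (A : Site d → Fin d → Matrix n n ℂ)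
    {Cc Cd : ℝ} (hCc0 : 0 ≤ Cc)
    (hCc : ∀ (q : Site d) (μ ν : Fin d), (∀ i, lo i ≤ q i ∧ q i < lo i + M) → (∀ i, lo i ≤ (q + e μ) i ∧ (q + e μ) i < lo i + M) →
      (∀ i, lo i ≤ (q + e ν) i ∧ (q + e ν) i < lo i + M) → (∀ i, lo i ≤ (q + e μ + e ν) i ∧ (q + e μ + e ν) i < lo i + M) →
      ‖A q μ + A (q + e μ) ν - A (q + e ν) μ - A q ν‖ ≤ Cc)
    (hCd : ∀ y : Site d, (∀ i, lo i ≤ y i ∧ y i < lo i + M) →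
      ‖∑ κ, ((if (∀ i, lo i ≤ (y + e κ) i ∧ (y + e κ) i < lo i + M) then A y κ else 0)
            - (if (∀ i, lo i ≤ (y - e κ) i ∧ (y - e κ) i < lo i + M) then A (y - e κ) κ else 0))‖ ≤ Cd)
    {x : Site d} {μ : Fin d} (hx : ∀ i, lo i ≤ x i ∧ x i < lo i + M) (hxμ : ∀ i, lo i ≤ (x + e μ) i ∧ (x + e μ) i < lo i + M) :
    ‖A x μ‖ ≤ 64 * (d : ℝ) ^ 2 * M * ((d : ℝ) * Cc + Cd) := by
  obtain ⟨Φ, R, hΦmem, -, hR⟩ := exists_box_reflection (E := Matrix n n ℂ) hM lo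
  obtain ⟨hper, hself, hface, -, hcurl, hdiv, -⟩ := hR A
  have hP : 1 ≤ 2 * M := by omega
  -- the doubled field on the torus of period `2M`
  have hcurl' : ∀ (y : Site d) (μ ν : Fin d), ‖R A y μ + R A (y + e μ) ν - R A (y + e ν) μ - R A y ν‖ ≤ Cc := by
    intro y μ ν
    by_cases hμν : μ = ν
    · subst hμν; rw [show R A y μ + R A (y + e μ) μ - R A (y + e μ) μ - R A y μ = 0 by abel, norm_zero]; exact hCc0
    · exact hcurl Cc hCc0 hCc y μ ν hμν
  have hdiv' : ∀ y : Site d, ‖∑ κ, (R A y κ - R A (y - e κ) κ)‖ ≤ Cd := fun y => by rw [hdiv y]; exact hCd (Φ y) (hΦmem y)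
  have hosc := osc_le_of_curl_div hd hP (R A) (fun y τ κ => hper y τ κ) hcurl' hdiv' x (lo + ((M : ℤ) - 1) • e μ) μ
  rw [hface μ, sub_zero, hself x μ hx hxμ] at hosc
  calc ‖A x μ‖ ≤ 2 * (16 * (d : ℝ) ^ 2 * ((2 * M : ℕ) : ℝ) * ((d : ℝ) * Cc + Cd)) := hosc
    _ = 64 * (d : ℝ) ^ 2 * M * ((d : ℝ) * Cc + Cd) := by push_cast; ring

/-! ## §2 The Landau letter on the box -/

variable [Nonempty n]

/-- **THE LINEAR CURL FROM THE PLAQUETTE OF `e^{A}`**: for `‖Aᵢ‖ ≤ ρ` (four bonds) and `‖e^{A₁}e^{A₂}e^{−A₃}e^{−A₄} − 1‖ ≤ ε`,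
`‖A₁ + A₂ − A₃ − A₄‖ ≤ ε + 4ρ(e^{4ρ} − 1)` ((157)'s remainder letter at `y = 0`). [folklore] -/
theorem norm_plaq_linear_le {A₁ A₂ A₃ A₄ : Matrix n n ℂ} {ρ ε : ℝ} (h1 : ‖A₁‖ ≤ ρ) (h2 : ‖A₂‖ ≤ ρ) (h3 : ‖A₃‖ ≤ ρ) (h4 : ‖A₄‖ ≤ ρ)
    (hp : ‖exp A₁ * exp A₂ * exp (-A₃) * exp (-A₄) - 1‖ ≤ ε) :
    ‖A₁ + A₂ - A₃ - A₄‖ ≤ ε + 4 * ρ * (Real.exp (4 * ρ) - 1) := by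
  have hρ : 0 ≤ ρ := (norm_nonneg _).trans h1
  have h0 : ‖(0 : Matrix n n ℂ)‖ ≤ ρ := by rw [norm_zero]; exact hρ
  have hrem := norm_plaqRem_sub_plaqRem_le (x₁ := A₁) (x₂ := A₂) (x₃ := -A₃) (x₄ := -A₄) (y₁ := 0) (y₂ := 0) (y₃ := 0) (y₄ := 0)
    (ρ := ρ) h1 h2 (by rwa [norm_neg]) (by rwa [norm_neg]) h0 h0 h0 h0
  simp only [exp_zero, mul_one, sub_self, add_zero, sub_zero, norm_neg] at hrem
  have hsum : ‖A₁‖ + ‖A₂‖ + ‖A₃‖ + ‖A₄‖ ≤ 4 * ρ := by linarith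
  have hexp : 0 ≤ Real.exp (4 * ρ) - 1 := by linarith [Real.add_one_le_exp (4 * ρ)]
  have hrem' : ‖exp A₁ * exp A₂ * exp (-A₃) * exp (-A₄) - 1 - (A₁ + A₂ + -A₃ + -A₄)‖ ≤ 4 * ρ * (Real.exp (4 * ρ) - 1) := by
    calc _ ≤ (Real.exp (4 * ρ) - 1) * (‖A₁‖ + ‖A₂‖ + ‖A₃‖ + ‖A₄‖) := hrem
      _ ≤ (Real.exp (4 * ρ) - 1) * (4 * ρ) := mul_le_mul_of_nonneg_left hsum hexp
      _ = 4 * ρ * (Real.exp (4 * ρ) - 1) := by ring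
  have hid : A₁ + A₂ - A₃ - A₄ = (exp A₁ * exp A₂ * exp (-A₃) * exp (-A₄) - 1)
      - (exp A₁ * exp A₂ * exp (-A₃) * exp (-A₄) - 1 - (A₁ + A₂ + -A₃ + -A₄)) := by abel
  rw [hid]
  exact (norm_sub_le _ _).trans (add_le_add hp hrem')

/-- **THE FREE-BOUNDARY DIVERGENCE OF `A` FROM THE EULER–LAGRANGE CONDITION**: if `‖A‖ ≤ ρ` on the present bonds at `y` and
`Σ_κ [𝟙⁺_κ (e^{A(y)_κ} − e^{−A(y)_κ}) − 𝟙⁻_κ (e^{A(y−e_κ)_κ} − e^{−A(y−e_κ)_κ})] = 0` (any indicators), then the free divergence of `A` obeys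
`‖Σ_κ [𝟙⁺_κ A(y)_κ − 𝟙⁻_κ A(y−e_κ)_κ]‖ ≤ 2d·ρ(e^ρ − 1)` (`sinh − id` is `(e^ρ−1)`-Lipschitz, (158b)). [folklore] -/
theorem norm_freeDiv_le_of_EL (A : Site d → Fin d → Matrix n n ℂ) (y : Site d) (P Q : Fin d → Prop) [DecidablePred P] [DecidablePred Q]
    {ρ : ℝ} (hρ : 0 ≤ ρ)
    (hA : ∀ κ, P κ → ‖A y κ‖ ≤ ρ) (hA' : ∀ κ, Q κ → ‖A (y - e κ) κ‖ ≤ ρ)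
    (hEL : ∑ κ, ((if P κ then (exp (A y κ) - exp (-A y κ)) else 0) - (if Q κ then (exp (A (y - e κ) κ) - exp (-A (y - e κ) κ)) else 0)) = 0) :
    ‖∑ κ, ((if P κ then A y κ else 0) - (if Q κ then A (y - e κ) κ else 0))‖ ≤ 2 * (d : ℝ) * (ρ * (Real.exp ρ - 1)) := by
  have hexp : 0 ≤ Real.exp ρ - 1 := by linarith [Real.add_one_le_exp ρ]
  -- `sinh − id` termwise
  have hrem : ∀ X : Matrix n n ℂ, ‖X‖ ≤ ρ → ‖X - (2 : ℂ)⁻¹ • (exp X - exp (-X))‖ ≤ ρ * (Real.exp ρ - 1) := by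
    intro X hX
    have h0 : ‖(0 : Matrix n n ℂ)‖ ≤ ρ := by rw [norm_zero]; exact hρ
    have h1 := norm_sinhRem_sub_sinhRem_le (X := X) (Y := (0 : Matrix n n ℂ)) (ρ := ρ) hX h0
    simp only [neg_zero, exp_zero, sub_self, smul_zero, sub_zero] at h1
    rw [norm_sub_rev]
    calc _ ≤ (Real.exp ρ - 1) * ‖X‖ := h1
      _ ≤ (Real.exp ρ - 1) * ρ := mul_le_mul_of_nonneg_left hX hexp
      _ = ρ * (Real.exp ρ - 1) := by ring
  -- the half-EL
  have hEL' : ∑ κ, ((if P κ then (2 : ℂ)⁻¹ • (exp (A y κ) - exp (-A y κ)) else 0)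
      - (if Q κ then (2 : ℂ)⁻¹ • (exp (A (y - e κ) κ) - exp (-A (y - e κ) κ)) else 0)) = 0 := by
    have h : ∑ κ, ((if P κ then (2 : ℂ)⁻¹ • (exp (A y κ) - exp (-A y κ)) else 0)
        - (if Q κ then (2 : ℂ)⁻¹ • (exp (A (y - e κ) κ) - exp (-A (y - e κ) κ)) else 0))
        = (2 : ℂ)⁻¹ • ∑ κ, ((if P κ then (exp (A y κ) - exp (-A y κ)) else 0)
            - (if Q κ then (exp (A (y - e κ) κ) - exp (-A (y - e κ) κ)) else 0)) := by
      rw [Finset.smul_sum]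
      refine Finset.sum_congr rfl fun κ _ => ?_
      by_cases hP : P κ <;> by_cases hQ : Q κ <;> simp [hP, hQ, smul_sub]
    rw [h, hEL, smul_zero]
  have hid : ∑ κ, ((if P κ then A y κ else 0) - (if Q κ then A (y - e κ) κ else 0))
      = ∑ κ, (((if P κ then A y κ else 0) - (if P κ then (2 : ℂ)⁻¹ • (exp (A y κ) - exp (-A y κ)) else 0))
          - ((if Q κ then A (y - e κ) κ else 0) - (if Q κ then (2 : ℂ)⁻¹ • (exp (A (y - e κ) κ) - exp (-A (y - e κ) κ)) else 0)))
        + ∑ κ, ((if P κ then (2 : ℂ)⁻¹ • (exp (A y κ) - exp (-A y κ)) else 0)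
          - (if Q κ then (2 : ℂ)⁻¹ • (exp (A (y - e κ) κ) - exp (-A (y - e κ) κ)) else 0)) := by
    rw [← Finset.sum_add_distrib]; exact Finset.sum_congr rfl fun κ _ => by abel
  rw [hid, hEL', add_zero]
  calc _ ≤ ∑ κ : Fin d, (ρ * (Real.exp ρ - 1) + ρ * (Real.exp ρ - 1)) := by
        refine norm_sum_le_of_le _ fun κ _ => (norm_sub_le _ _).trans (add_le_add ?_ ?_)
        · by_cases hP : P κ
          · rw [if_pos hP, if_pos hP]; exact hrem _ (hA κ hP)
          · rw [if_neg hP, if_neg hP, sub_zero, norm_zero]; positivity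
        · by_cases hQ : Q κ
          · rw [if_pos hQ, if_pos hQ]; exact hrem _ (hA' κ hQ)
          · rw [if_neg hQ, if_neg hQ, sub_zero, norm_zero]; positivity
    _ = 2 * (d : ℝ) * (ρ * (Real.exp ρ - 1)) := by
        rw [Finset.sum_const, Finset.card_univ, Fintype.card_fin, nsmul_eq_mul]; ring

set_option maxHeartbeats 800000 in
/-- **THE A PRIORI SUP LETTER OF A FREE-BOUNDARY LATTICE LANDAU GAUGE ON A BOX — NO LOGARITHM** (`d ≥ 1`, `M ≥ 2`).  Let `A` be a bond field with
`‖A‖ ≤ ρ` on the bonds of the box `lo + [0,M)ᵈ`, whose exponential `W = e^{A}` has small plaquettes `‖e^{A₁}e^{A₂}e^{−A₃}e^{−A₄} − 1‖ ≤ ε` on every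
plaquette with its corners in the box, and which satisfies the free-boundary Euler–Lagrange (Neumann lattice Landau) condition
`Σ_κ [𝟙(y+e_κ ∈ box)(e^{A(y)_κ} − e^{−A(y)_κ}) − 𝟙(y−e_κ ∈ box)(e^{A(y−e_κ)_κ} − e^{−A(y−e_κ)_κ})] = 0` at every box site.  Then on every box bond
`‖A(x)_μ‖ ≤ 64d³M·(ε + 4ρ(e^{4ρ} − 1) + 2ρ(e^ρ − 1))`. [folklore] -/
theorem landau_box_sup_le (hd : 1 ≤ d) {M : ℕ} (hM : 2 ≤ M) (lo : Site d) (A : Site d → Fin d → Matrix n n ℂ) {ρ ε : ℝ} (hε : 0 ≤ ε)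
    (hA : ∀ (y : Site d) (κ : Fin d), (∀ i, lo i ≤ y i ∧ y i < lo i + M) → (∀ i, lo i ≤ (y + e κ) i ∧ (y + e κ) i < lo i + M) → ‖A y κ‖ ≤ ρ)
    (hplaq : ∀ (q : Site d) (μ ν : Fin d), μ ≠ ν → (∀ i, lo i ≤ q i ∧ q i < lo i + M) → (∀ i, lo i ≤ (q + e μ) i ∧ (q + e μ) i < lo i + M) →
      (∀ i, lo i ≤ (q + e ν) i ∧ (q + e ν) i < lo i + M) → (∀ i, lo i ≤ (q + e μ + e ν) i ∧ (q + e μ + e ν) i < lo i + M) →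
      ‖exp (A q μ) * exp (A (q + e μ) ν) * exp (-A (q + e ν) μ) * exp (-A q ν) - 1‖ ≤ ε)
    (hEL : ∀ y : Site d, (∀ i, lo i ≤ y i ∧ y i < lo i + M) →
      ∑ κ, ((if (∀ i, lo i ≤ (y + e κ) i ∧ (y + e κ) i < lo i + M) then (exp (A y κ) - exp (-A y κ)) else 0)
          - (if (∀ i, lo i ≤ (y - e κ) i ∧ (y - e κ) i < lo i + M) then (exp (A (y - e κ) κ) - exp (-A (y - e κ) κ)) else 0)) = 0)
    {x : Site d} {μ : Fin d} (hx : ∀ i, lo i ≤ x i ∧ x i < lo i + M) (hxμ : ∀ i, lo i ≤ (x + e μ) i ∧ (x + e μ) i < lo i + M) :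
    ‖A x μ‖ ≤ 64 * (d : ℝ) ^ 3 * M * (ε + 4 * ρ * (Real.exp (4 * ρ) - 1) + 2 * (ρ * (Real.exp ρ - 1))) := by
  have hρ : 0 ≤ ρ := (norm_nonneg _).trans (hA x μ hx hxμ)
  have he4 : 0 ≤ Real.exp (4 * ρ) - 1 := by linarith [Real.add_one_le_exp (4 * ρ)]
  have he1 : 0 ≤ Real.exp ρ - 1 := by linarith [Real.add_one_le_exp ρ]
  set Cc : ℝ := ε + 4 * ρ * (Real.exp (4 * ρ) - 1) with hCc_def
  set Cd : ℝ := 2 * (d : ℝ) * (ρ * (Real.exp ρ - 1)) with hCd_def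
  have hCc0 : 0 ≤ Cc := by positivity
  -- the box curls
  have hCc : ∀ (q : Site d) (μ ν : Fin d), (∀ i, lo i ≤ q i ∧ q i < lo i + M) → (∀ i, lo i ≤ (q + e μ) i ∧ (q + e μ) i < lo i + M) →
      (∀ i, lo i ≤ (q + e ν) i ∧ (q + e ν) i < lo i + M) → (∀ i, lo i ≤ (q + e μ + e ν) i ∧ (q + e μ + e ν) i < lo i + M) →
      ‖A q μ + A (q + e μ) ν - A (q + e ν) μ - A q ν‖ ≤ Cc := by
    intro q μ ν hq hqμ hqν hqμν
    by_cases hμν : μ = ν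
    · subst hμν; rw [show A q μ + A (q + e μ) μ - A (q + e μ) μ - A q μ = 0 by abel, norm_zero]; exact hCc0
    · have hqνμ : ∀ i, lo i ≤ (q + e ν + e μ) i ∧ (q + e ν + e μ) i < lo i + M := by rw [add_right_comm]; exact hqμν
      exact norm_plaq_linear_le (hA q μ hq hqμ) (hA (q + e μ) ν hqμ hqμν) (hA (q + e ν) μ hqν hqνμ) (hA q ν hq hqν)
        (hplaq q μ ν hμν hq hqμ hqν hqμν)
  -- the free divergence
  have hCd : ∀ y : Site d, (∀ i, lo i ≤ y i ∧ y i < lo i + M) →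
      ‖∑ κ, ((if (∀ i, lo i ≤ (y + e κ) i ∧ (y + e κ) i < lo i + M) then A y κ else 0)
            - (if (∀ i, lo i ≤ (y - e κ) i ∧ (y - e κ) i < lo i + M) then A (y - e κ) κ else 0))‖ ≤ Cd := by
    intro y hy
    refine norm_freeDiv_le_of_EL A y _ _ hρ (fun κ hκ => hA y κ hy hκ) (fun κ hκ => hA (y - e κ) κ hκ ?_) (hEL y hy)
    rw [sub_add_cancel]; exact hy
  have h := box_sup_le_of_curl_freeDiv hd hM lo A hCc0 hCc hCd hx hxμ
  calc ‖A x μ‖ ≤ 64 * (d : ℝ) ^ 2 * M * ((d : ℝ) * Cc + Cd) := h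
    _ = 64 * (d : ℝ) ^ 3 * M * (ε + 4 * ρ * (Real.exp (4 * ρ) - 1) + 2 * (ρ * (Real.exp ρ - 1))) := by
        rw [hCc_def, hCd_def]; ring

/-- **THE SAME WITH EXPLICIT SMALL-`ρ` NUMERICS**: for `ρ ≤ 1∕4`, `4ρ(e^{4ρ} − 1) + 2ρ(e^ρ − 1) ≤ 36ρ²`, so the Landau letter reads
`‖A(x)_μ‖ ≤ 64d³M·(ε + 36ρ²)`. [folklore] -/
theorem landau_box_sup_le' (hd : 1 ≤ d) {M : ℕ} (hM : 2 ≤ M) (lo : Site d) (A : Site d → Fin d → Matrix n n ℂ) {ρ ε : ℝ} (hε : 0 ≤ ε)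
    (hρ4 : ρ ≤ 1 / 4)
    (hA : ∀ (y : Site d) (κ : Fin d), (∀ i, lo i ≤ y i ∧ y i < lo i + M) → (∀ i, lo i ≤ (y + e κ) i ∧ (y + e κ) i < lo i + M) → ‖A y κ‖ ≤ ρ)
    (hplaq : ∀ (q : Site d) (μ ν : Fin d), μ ≠ ν → (∀ i, lo i ≤ q i ∧ q i < lo i + M) → (∀ i, lo i ≤ (q + e μ) i ∧ (q + e μ) i < lo i + M) →
      (∀ i, lo i ≤ (q + e ν) i ∧ (q + e ν) i < lo i + M) → (∀ i, lo i ≤ (q + e μ + e ν) i ∧ (q + e μ + e ν) i < lo i + M) →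
      ‖exp (A q μ) * exp (A (q + e μ) ν) * exp (-A (q + e ν) μ) * exp (-A q ν) - 1‖ ≤ ε)
    (hEL : ∀ y : Site d, (∀ i, lo i ≤ y i ∧ y i < lo i + M) →
      ∑ κ, ((if (∀ i, lo i ≤ (y + e κ) i ∧ (y + e κ) i < lo i + M) then (exp (A y κ) - exp (-A y κ)) else 0)
          - (if (∀ i, lo i ≤ (y - e κ) i ∧ (y - e κ) i < lo i + M) then (exp (A (y - e κ) κ) - exp (-A (y - e κ) κ)) else 0)) = 0)
    {x : Site d} {μ : Fin d} (hx : ∀ i, lo i ≤ x i ∧ x i < lo i + M) (hxμ : ∀ i, lo i ≤ (x + e μ) i ∧ (x + e μ) i < lo i + M) :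
    ‖A x μ‖ ≤ 64 * (d : ℝ) ^ 3 * M * (ε + 36 * ρ ^ 2) := by
  have hρ : 0 ≤ ρ := (norm_nonneg _).trans (hA x μ hx hxμ)
  have h := landau_box_sup_le hd hM lo A hε hA hplaq hEL hx hxμ
  have h1 : Real.exp (4 * ρ) - 1 ≤ 2 * (4 * ρ) := by
    have h4 : |4 * ρ| ≤ 1 := by rw [abs_of_nonneg (by linarith : (0 : ℝ) ≤ 4 * ρ)]; linarith
    have := Real.abs_exp_sub_one_le h4
    rw [abs_of_nonneg (by linarith : (0 : ℝ) ≤ 4 * ρ)] at this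
    exact (le_abs_self _).trans this
  have h2 : Real.exp ρ - 1 ≤ 2 * ρ := by
    have h4 : |ρ| ≤ 1 := by rw [abs_of_nonneg hρ]; linarith
    have := Real.abs_exp_sub_one_le h4
    rw [abs_of_nonneg hρ] at this
    exact (le_abs_self _).trans this
  have h3 : 4 * ρ * (Real.exp (4 * ρ) - 1) + 2 * (ρ * (Real.exp ρ - 1)) ≤ 36 * ρ ^ 2 := by nlinarith
  have hK : 0 ≤ 64 * (d : ℝ) ^ 3 * M := by positivity
  calc ‖A x μ‖ ≤ _ := h
    _ ≤ 64 * (d : ℝ) ^ 3 * M * (ε + 36 * ρ ^ 2) := mul_le_mul_of_nonneg_left (by linarith) hK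

end

end Summit.QuantumFields.BalabanUV.T4Continuum.NE7BoxLandauSupAPriori
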